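import Literature.Computability.Complexity.SymmetricCircuitCompose
import Literature.Computability.Complexity.DeMorganSimulation
import Literature.Computability.Complexity.CircuitClassesUniformProofs
import Literature.Computability.Complexity.ClayProblemProofs
import Summits.PneNP.PneNP.Theorems.HamCompiles.Negative.NonuniformCollapse
import Summits.PneNP.PneNP.Theorems.HamCompiles.Negative.Irrefutable
import Summits.PneNP.PneNP.Theorems.SymmetryBudgetHamCompilesStubKotzig
import Summits.PneNP.PneNP.Theorems.SymmetryBudgetHamCompilesStubCutspan
import Summits.PneNP.PneNP.Theorems.SymmetryBudgetHamCompilesStubRref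
import Summits.PneNP.PneNP.Theorems.SymmetryBudgetHamCompilesStubSymmetricA
import Summits.PneNP.PneNP.Theorems.SymmetryBudgetHamCompilesStubSpanRecursion
import Summits.PneNP.PneNP.Theorems.SymmetryBudgetHamCompilesStubSymmetricF
import Summits.PneNP.PneNP.Theorems.SymmetryBudgetHamCompilesStubResidueNP

/-!
# `SymmetryBudget.HamCompiles` (crux stmt-PneNP-10637): the equivariant compilation, line `kotzig-cutspan`

Closing file of the line (lead prover-line-stmt-PneNP-10637-0): the registered skeleton
`Summits/PneNP/PneNP/Cruxes/HamCompiles/Lines/kotzig-cutspan.lean` with its seven stubs replaced by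
the landed theorems `stub_kotzig` (Kotzig junction lemma), `stub_cutspan` (cut parity + linearity),
`stub_rref` (reduced echelon tables over `GF(2)`, stars-and-bars code), `stub_spanRecursion`
(`W_F(d)` = the span recursion), `stub_symmetricA` / `stub_symmetricF` (polynomial-size
Bud-symmetric threshold circuits for every interface bit), `stub_residueNP` (`ResidueLang ∈ NP`).

COMPOSITION. `HamCompiles` unfolds to `NP ⊆ P → ∃ p ∀ m, HasSymCircuit tcBasis (Bud m ⌊log₂ m⌋)
(p m) HAM_m` (`Negative.hamCompiles_iff`). `NP ⊆ P` (Cook) ⇒ `NP ⊆ P/poly` by the PROVED bridges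
`NP_bool_eq_holds`, `P_bool_eq_holds`, `P_subset_PPoly_holds` ⇒ `ResidueLang ∈ SIZE(p₁)`
(`stub_residueNP`) ⇒ bolt the `p₁(ell m)`-size `B₂` circuit (rewritten over `{∧₂,∨₂,¬}`) onto the
`ell m` Bud-symmetric interface circuits of size `q(m)` (`stub_symmetricA`, `stub_symmetricF`;
`GateList.hasSymCircuit_postcompose`) ⇒ the composite computes `HAM_m` for `m ≥ 4` because the
interface decides Hamiltonicity: `HAM_m(x) ⟺ KotzigPred ⟺ Residue₀ m x ⟺ Residue m (aData m x)
(fData m x)` (`stub_kotzig`, `stub_cutspan`, `stub_spanRecursion` + `stub_rref` + linearity) and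
membership of the interface string in `ResidueLang` is that predicate; `m ≤ 3` is padded by a
constant (trivial budget). Hence the hypothesis-light `hamCompilesPPoly : NP ⊆ P/poly → Concl`
(Disproof §11's `HamCompilesPPoly`) and `HamCompiles_of : HamCompiles`; the deciding theorem
`Summit.PneNP.PneNP.Theorems.HamCompiles_proof` restates it by name.
-/

-- `Summit.PneNP.PneNP.…` duplicates `PneNP` BY DESIGN (single-problem summit, D-0017).
set_option linter.dupNamespace false

noncomputable section

namespace Summit.PneNP.PneNP.Theorems.HamCompilesKC

open Literature.Computability.Complexity
open Summit.PneNP.PneNP.Theses.SymmetryBudget (HamCompiles)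
open Summit.PneNP.PneNP.Theorems.HamCompiles.Negative (hamCompiles_iff deMorganBasis_subset_tcBasis
  exists_circuit_ham)
open Finset

/-! ### Bolting a circuit onto symmetric circuits with fixed output wires -/


/-- **Composition** (Anderson–Dawar §2 "invariant post-composition", from the tree's
`GateList.hasSymCircuit_postcompose`). If `Y₀,…,Y_{k-1}` are `Γ`-symmetric threshold circuits of size `≤ s` on the matrix
`x`, and `D` is ANY `B₂`-circuit on `k > 0` inputs of size `≤ t`, then `x ↦ D(Y₀(x),…,Y_{k-1}(x))`
has a `Γ`-symmetric threshold circuit of size `≤ k·s + 12·t + 4`: rewrite `D` over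
`{∧₂,∨₂,¬} ⊆ tcBasis` (`Circuit.exists_deMorgan_of_B2`, `≤ 12t+3` gates) and bolt it onto the layer
of the `Yᵢ` (`GateList.hasSymCircuit_postcompose`: automorphism `σ₀ ⊕ ⋯ ⊕ σ_{k-1} ⊕ id`). -/
theorem hasSymCircuit_compose {m k s t : ℕ} (Γ : Set (Equiv.Perm (Fin m)))
    (Y : Fin k → Circuit (Fin m × Fin m))
    (hY : ∀ i, (Y i).IsOver tcBasis ∧ (Y i).size ≤ s ∧ (Y i).IsSymmetricUnder Γ)
    (D : Circuit (Fin k)) (hD : D.IsOver B2) (hDt : D.size ≤ t) (hk : 0 < k) :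
    HasSymCircuit tcBasis Γ (k * s + 12 * t + 4) (fun x => D.eval fun i => (Y i).eval x) := by
  obtain ⟨D', hD'B, hD'f, hD's⟩ :=
    D.exists_deMorgan_of_B2 hD ⟨0, hk⟩ (f := D.eval) (fun _ => rfl)
  have h := GateList.hasSymCircuit_postcompose (Γ := Γ) Y (fun i => (Y i).eval)
    (fun i => (hY i).1) (fun i => (hY i).2.2) (fun i => (hY i).2.1) (fun _ _ => rfl) D'
    (hD'B.mono deMorganBasis_subset_tcBasis) hD'f
  refine h.mono ?_
  have h1 : D'.size ≤ 12 * t + 4 := by omega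
  simpa [Nat.add_assoc] using Nat.add_le_add_left h1 (k * s)

/-! ### The composition -/

/-! #### Bridges: Cook's hypothesis gives `NP ⊆ P/poly` (proved tree facts) -/

/-- `NP ⊆ P` (Cook's classes over `{0,1}`) gives `Nondeterministic.NP ⊆ P/poly`, by the PROVED
model bridges `NP_bool_eq_holds`, `P_bool_eq_holds` and `P_subset_PPoly_holds`. -/
theorem np_subset_ppoly_of_npsubp (h : PNPWave0.NP Bool ⊆ PNPWave0.P Bool) :
    Nondeterministic.NP ⊆ PPoly := by
  intro L hL
  have e₁ : PNPWave0.NP Bool = Nondeterministic.NP := NP_bool_eq_holds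
  have e₂ : PNPWave0.P Bool = Classes.P := P_bool_eq_holds
  have h₁ : L ∈ PNPWave0.NP Bool := by rw [e₁]; exact hL
  have h₂ : L ∈ Classes.P := by rw [← e₂]; exact h h₁
  exact P_subset_PPoly_holds h₂

/-! #### Small `m`: the budget is trivial, some circuit exists -/

/-- For `m ≤ 3` the budget `⌊log₂ m⌋ ≤ 1` frees at most one vertex: every `ρ ∈ Bud` is `1`. -/
theorem bud_subset_one {m : ℕ} (hm : m < 4) : Bud m (Nat.log 2 m) ⊆ {1} := by
  have hlog : Nat.log 2 m ≤ 1 := by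
    rcases Nat.eq_zero_or_pos m with rfl | hpos
    · simp
    · exact Nat.lt_succ_iff.1 (Nat.log_lt_of_lt_pow hpos.ne' (by norm_num; omega))
  intro ρ h
  rw [Set.mem_singleton_iff]
  refine Equiv.ext fun i => ?_
  show ρ i = i
  by_cases hi : (i : ℕ) + Nat.log 2 m < m
  · exact h i hi
  · by_contra hne
    have hj : ((ρ i : Fin m) : ℕ) + Nat.log 2 m < m := by
      have h1 : ((ρ i : Fin m) : ℕ) ≠ (i : ℕ) := fun e => hne (Fin.ext e)
      have h2 := (ρ i).2
      have h3 := i.2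
      omega
    exact hne (ρ.injective (h (ρ i) hj))


/-- Small `m`: a Bud-symmetric threshold circuit for `HAM_m` exists (any circuit is symmetric under
the trivial budget). -/
theorem hasSym_small {m : ℕ} (hm : m < 4) :
    ∃ s : ℕ, HasSymCircuit tcBasis (Bud m (Nat.log 2 m)) s (hamFn m) := by
  obtain ⟨s, C, hB, hs, hf⟩ := exists_circuit_ham m
  exact ⟨s, C, hB, hs, C.isSymmetricUnder_one.mono (bud_subset_one hm), hf⟩

/-! #### Arithmetic -/

/-- Evaluation of an `ℕ`-polynomial is monotone in the argument. -/
theorem eval_mono_nat (p : Polynomial ℕ) {a b : ℕ} (h : a ≤ b) : p.eval a ≤ p.eval b := by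
  induction p using Polynomial.induction_on' with
  | add p q hp hq => simp only [Polynomial.eval_add]; exact Nat.add_le_add hp hq
  | monomial n c =>
    simp only [Polynomial.eval_monomial]
    exact Nat.mul_le_mul_left c (Nat.pow_le_pow_left h n)

/-- The polynomial bounding `ell`. -/
def ellPoly : Polynomial ℕ := Polynomial.C 2 * Polynomial.X ^ 2 + Polynomial.X ^ 5

/-- Evaluation of `ellPoly`. -/
theorem ellPoly_eval (m : ℕ) : ellPoly.eval m = 2 * m ^ 2 + m ^ 5 := by
  simp [ellPoly]

/-- For `m ≥ 4` the budget is at least `2`. -/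
theorem four_le_two_pow_gOf {m : ℕ} (hm : 4 ≤ m) : 2 ≤ gOf m :=
  Nat.le_log_of_pow_le (by norm_num) (by simpa using hm)

/-- `ell m ≤ 2m² + m⁵`. -/
theorem ell_le {m : ℕ} (hm : m ≠ 0) : ell m ≤ ellPoly.eval m := by
  have hg : gOf m ≤ m := Nat.log_le_self 2 m
  have h2 : 2 ^ gOf m ≤ m := Nat.pow_log_le_self 2 hm
  have h3 : 2 ^ (3 * gOf m) ≤ m ^ 3 := by
    rw [mul_comm, pow_mul]
    exact Nat.pow_le_pow_left h2 3
  rw [ellPoly_eval]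
  unfold ell
  have hm2 : m * m = m ^ 2 := (sq m).symm
  calc (m * m + gOf m * m) + 2 ^ (3 * gOf m) * (2 ^ gOf m * 2 ^ gOf m)
      ≤ (m * m + m * m) + m ^ 3 * (m * m) := by gcongr
    _ = 2 * m ^ 2 + m ^ 5 := by ring

/-- The interface string is nonempty for `m ≥ 4`. -/
theorem ell_pos {m : ℕ} (hm : 4 ≤ m) : 0 < ell m := by
  unfold ell
  have : 0 < m * m := Nat.mul_pos (by omega) (by omega)
  omega

/-- `ell` is strictly increasing, so `m` is read off the length of the interface string. -/
theorem ell_strictMono : StrictMono ell := by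
  intro a b hab
  unfold ell
  have hg : gOf a ≤ gOf b := Nat.log_mono_right hab.le
  have h1 : a * a < b * b := Nat.mul_self_lt_mul_self hab
  have h2 : gOf a * a ≤ gOf b * b := Nat.mul_le_mul hg hab.le
  have h3 : 2 ^ (3 * gOf a) * (2 ^ gOf a * 2 ^ gOf a) ≤ 2 ^ (3 * gOf b) * (2 ^ gOf b * 2 ^ gOf b) := by
    gcongr <;> omega
  omega

/-! #### The interface string: decoding `m` and the blocks -/

/-- The layout of the interface is injective. -/
theorem encode_injective (m : ℕ) : Function.Injective (encode m) := by
  intro v w h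
  have h' := List.ofFn_injective h
  funext i
  have := congrFun h' ((iIdxEquiv m) i)
  simpa using this

/-- Membership of an interface string in the residual language is the residual predicate of its
blocks (`ell` is injective, `encode m` is injective). -/
theorem encode_mem_residueLang_iff {m : ℕ} (hm : 4 ≤ m) (ab : AIdx m → Bool) (fb : FIdx m → Bool) :
    encode m (Sum.elim ab fb) ∈ ResidueLang ↔ Residue m ab fb := by
  constructor
  · rintro ⟨m', -, ab', fb', hs, hR⟩
    have hmm : m = m' := by
      have := congrArg List.length hs
      rw [encode_length, encode_length] at this
      exact ell_strictMono.injective this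
    subst hmm
    have hv := encode_injective m hs
    have ha : ab = ab' := funext fun i => by simpa using congrFun hv (Sum.inl i)
    have hf : fb = fb' := funext fun i => by simpa using congrFun hv (Sum.inr i)
    subst ha hf
    exact hR
  · intro hR
    exact ⟨m, hm, ab, fb, rfl, hR⟩

/-- Evaluating a circuit family on `List.ofFn F` is evaluating its `n`-th circuit on `F`. -/
theorem eval_length_cast (C : CircuitFamily) (l : List Bool) {n : ℕ} (h : l.length = n)
    (F : Fin n → Bool) (hF : ∀ j : Fin l.length, l.get j = F (Fin.cast h j)) :
    (C l.length).eval l.get = (C n).eval F := by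
  subst h
  have : l.get = F := funext fun j => hF j
  rw [this]

/-- Evaluating a circuit family on `List.ofFn F` is evaluating its `n`-th circuit on `F`. -/
theorem eval_ofFn (C : CircuitFamily) {n : ℕ} (F : Fin n → Bool) :
    (C (List.ofFn F).length).eval (List.ofFn F).get = (C n).eval F :=
  eval_length_cast C (List.ofFn F) (List.length_ofFn ..) F fun j => List.get_ofFn F j

/-! #### `HAM_m` through the interface -/

/-- `m ≥ 4` gives at least three vertices. -/
theorem card_fin_three_le {m : ℕ} (hm : 4 ≤ m) : 3 ≤ Fintype.card (Fin m) := by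
  rw [Fintype.card_fin]; omega

/-- The free part is nonempty for `m ≥ 4`. -/
theorem freeSet_nonempty {m : ℕ} (hm : 4 ≤ m) : (freeSet m).Nonempty := by
  refine ⟨⟨m - 1, by omega⟩, ?_⟩
  have hg : 2 ≤ gOf m := four_le_two_pow_gOf hm
  simp only [freeSet, Finset.mem_filter, Finset.mem_univ, true_and, IsAnch]
  omega

/-- The anchored part is nonempty for `m ≥ 4`. -/
theorem freeSet_compl_nonempty {m : ℕ} (hm : 4 ≤ m) : (freeSet m)ᶜ.Nonempty := by
  refine ⟨⟨0, by omega⟩, ?_⟩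
  have hg : gOf m < m := Nat.log_lt_self 2 (by omega)
  simp only [freeSet, Finset.mem_compl, Finset.mem_filter, Finset.mem_univ, true_and, IsAnch,
    not_not]
  simpa using hg


/-- **Row space** (from `stub_rref` (1) and (3)): the rows of the F-block at the code word of `d`
span exactly the closed state `Cspan F d`. -/
theorem rowSpace_fData {m : ℕ} (x : Fin m × Fin m → Bool) (d : Fin (gOf m) → ℕ)
    (hd : (∑ t, d t) ≤ 2 * gOf m) : rowSpace m (fData m x) (sbCode d) = Cspan m x (freeSet m) d := by
  have hrow : (fun S : Fin (gOf m) → Bool => fun S' : Fin (gOf m) → Bool =>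
      if fData m x (sbCode d, S, S') = true then (1 : ZMod 2) else 0) =
      rrefRow (Cspan m x (freeSet m) d) := by
    funext S S'
    have hiff : fData m x (sbCode d, S, S') = true ↔ rrefBit (Cspan m x (freeSet m) d) S S' := by
      unfold fData
      simp only [decide_eq_true_eq]
      constructor
      · rintro ⟨d', hd', hcode, hbit⟩
        have : d' = d := stub_rref.2.2 (gOf m) d' d hd' hd hcode
        subst this
        exact hbit
      · intro h
        exact ⟨d, hd, rfl, h⟩
    unfold rrefRow
    by_cases h : rrefBit (Cspan m x (freeSet m) d) S S'
    · rw [if_pos h, if_pos (hiff.2 h)]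
    · rw [if_neg h, if_neg (fun h' => h (hiff.1 h'))]
  unfold rowSpace
  rw [hrow]
  exact stub_rref.1 (gOf m) _

/-- **Glue**: the graph-level and the block-level residual predicates agree on the interface of
`x` (`stub_spanRecursion` + `stub_rref` + linearity). -/
theorem residue₀_iff_residue {m : ℕ} (x : Fin m × Fin m → Bool) :
    Residue₀ m x ↔ Residue m (aData m x) (fData m x) := by
  unfold Residue₀ Residue
  refine exists_congr fun d => and_congr_right fun hd => exists_congr fun PA =>
    and_congr_right fun _ => ?_
  rw [stub_spanRecursion m x d, ← rowSpace_fData x d hd]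
  unfold rowSpace
  rw [Cutspan.exists_mem_span_pairing_iff]
  simp only [Set.exists_range_iff]

/-- `HAM_m(x)` is the residual predicate of the interface of `x`
(`stub_kotzig` ∘ `stub_cutspan` ∘ glue). -/
theorem isHamiltonian_iff_residue {m : ℕ} (hm : 4 ≤ m) (x : Fin m × Fin m → Bool) :
    (Gr m x).IsHamiltonian ↔ Residue m (aData m x) (fData m x) :=
  ((stub_kotzig (Gr m x) (freeSet m) (card_fin_three_le hm) (freeSet_nonempty hm)
    (freeSet_compl_nonempty hm)).trans (stub_cutspan m hm x)).trans (residue₀_iff_residue x)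

/-- `HAM_m(x)` is Hamiltonicity of `Gr m x`. -/
theorem hamFn_eq_true_iff {m : ℕ} (x : Fin m × Fin m → Bool) :
    hamFn m x = true ↔ (Gr m x).IsHamiltonian := by
  simp [hamFn, Gr]

/-! #### Large `m`: compose -/

/-- The symmetric circuit for `HAM_m`, `m ≥ 4`, from: a `P/poly` family for the residual language,
and symmetric circuits for the interface bits. -/
theorem hasSym_of_blocks {m : ℕ} (hm : 4 ≤ m) {p₁ q : Polynomial ℕ} (C : CircuitFamily)
    (hC : ∀ n, (C n).IsOver B2 ∧ (C n).size ≤ p₁.eval n) (hDec : C.Decides ResidueLang)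
    (hq : ∀ i : IIdx m, HasSymCircuit tcBasis (Bud m (gOf m)) (q.eval m) (fun x => iface m x i)) :
    HasSymCircuit tcBasis (Bud m (gOf m)) (ell m * q.eval m + 12 * p₁.eval (ell m) + 4)
      (hamFn m) := by
  choose Y hY using hq
  have hcomp := hasSymCircuit_compose (Bud m (gOf m)) (fun j : Fin (ell m) => Y ((iIdxEquiv m).symm j))
    (fun j => ⟨(hY _).1, (hY _).2.1, (hY _).2.2.1⟩) (C (ell m)) (hC (ell m)).1 (hC (ell m)).2
    (ell_pos hm)
  have hfun : (fun x => (C (ell m)).eval fun j => (Y ((iIdxEquiv m).symm j)).eval x) = hamFn m := by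
    funext x
    have h1 : (fun j => (Y ((iIdxEquiv m).symm j)).eval x) =
        fun j => iface m x ((iIdxEquiv m).symm j) := funext fun j => (hY _).2.2.2 x
    have h2 : (C (ell m)).eval (fun j => iface m x ((iIdxEquiv m).symm j)) =
        ResidueLang.boolIndicator (encode m (iface m x)) := by
      rw [← eval_ofFn C]; exact hDec _
    rw [h1, h2, Bool.eq_iff_iff, ← Set.mem_iff_boolIndicator, hamFn_eq_true_iff,
      isHamiltonian_iff_residue hm]
    exact encode_mem_residueLang_iff hm (aData m x) (fData m x)
  rw [hfun] at hcomp
  exact hcomp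

/-- **The conclusion of the crux from `ResidueLang ∈ P/poly`.** -/
theorem concl_of_residueLang_mem_PPoly (hR : ResidueLang ∈ PPoly) :
    ∃ p : Polynomial ℕ, ∀ m : ℕ, HasSymCircuit tcBasis (Bud m (Nat.log 2 m)) (p.eval m) (hamFn m) := by
  obtain ⟨p₁, C, hC, hDec⟩ : ∃ p₁ : Polynomial ℕ, ∃ C : CircuitFamily,
      (∀ n, (C n).IsOver B2 ∧ (C n).size ≤ p₁.eval n) ∧ C.Decides ResidueLang := by
    obtain ⟨p₁, hp⟩ := Set.mem_iUnion.1 hR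
    obtain ⟨C, hC, hDec⟩ := hp
    exact ⟨p₁, C, hC, hDec⟩
  obtain ⟨qA, hqA⟩ := stub_symmetricA
  obtain ⟨qF, hqF⟩ := stub_symmetricF
  have hsmall : ∀ m, ∃ s : ℕ, m < 4 → HasSymCircuit tcBasis (Bud m (Nat.log 2 m)) s (hamFn m) := by
    intro m
    by_cases hm : m < 4
    · obtain ⟨s, hs⟩ := hasSym_small hm
      exact ⟨s, fun _ => hs⟩
    · exact ⟨0, fun h => absurd h hm⟩
  choose s hs using hsmall
  let q : Polynomial ℕ := qA + qF
  let c : ℕ := s 0 + s 1 + s 2 + s 3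
  refine ⟨ellPoly * q + Polynomial.C 12 * p₁.comp ellPoly + Polynomial.C (4 + c), fun m => ?_⟩
  have hPeval : (ellPoly * q + Polynomial.C 12 * p₁.comp ellPoly + Polynomial.C (4 + c)).eval m =
      ellPoly.eval m * q.eval m + 12 * p₁.eval (ellPoly.eval m) + (4 + c) := by
    simp [Polynomial.eval_comp]
  rw [hPeval]
  by_cases hm : m < 4
  · refine (hs m hm).mono ?_
    have : s m ≤ c := by interval_cases m <;> omega
    omega
  · push Not at hm
    have hq : ∀ i : IIdx m, HasSymCircuit tcBasis (Bud m (gOf m)) (q.eval m) (fun x => iface m x i) := by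
      rintro (i | i)
      · exact (hqA m hm i).mono (by simp [q])
      · exact (hqF m hm i).mono (by simp [q])
    have key := hasSym_of_blocks hm C hC hDec hq
    refine key.mono ?_
    have h1 : ell m ≤ ellPoly.eval m := ell_le (by omega)
    have h2 : p₁.eval (ell m) ≤ p₁.eval (ellPoly.eval m) := eval_mono_nat p₁ h1
    have h3 : ell m * q.eval m ≤ ellPoly.eval m * q.eval m := Nat.mul_le_mul_right _ h1
    omega

/-- **Transfer `C⁺` of the card (`HamCompilesPPoly`)**: the line never uses uniformity — it proves
the conclusion from `NP ⊆ P/poly` alone. (Hence, by Disproof §3/§6, on landing `WindowHam ↔ HamHardIO`.) -/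
theorem hamCompilesPPoly (h : Nondeterministic.NP ⊆ PPoly) :
    ∃ p : Polynomial ℕ, ∀ m : ℕ, HasSymCircuit tcBasis (Bud m (Nat.log 2 m)) (p.eval m) (hamFn m) :=
  concl_of_residueLang_mem_PPoly (h stub_residueNP)

/-- **Composition.** `HamCompiles` from the six stubs: unfold the crux (`Iff.rfl`) to
`NP ⊆ P → Concl`; Cook's hypothesis gives `NP ⊆ P/poly` (proved bridges), hence polynomial-size
`B₂`-circuits for the residual language (`stub_residueNP`); bolt them (`hasSymCircuit_compose`,
proved) onto the Bud-symmetric circuits of the interface bits (`stub_symmetricA`,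
`stub_symmetricF`); the composite computes `HAM_m` because the interface decides Hamiltonicity
(`stub_kotzig`, `stub_cutspan`, `stub_spanRecursion`, `stub_rref`); sizes are polynomial, and
`m ≤ 3` is padded by a constant. -/
theorem HamCompiles_of : HamCompiles :=
  hamCompiles_iff.2 fun hNP => by
    obtain ⟨p, hp⟩ := hamCompilesPPoly (np_subset_ppoly_of_npsubp hNP)
    exact ⟨p, fun m => hp m⟩

end Summit.PneNP.PneNP.Theorems.HamCompilesKC

namespace Summit.PneNP.PneNP.Theorems

/-- **Crux `HamCompiles` of route `PneNP/SymmetryBudget` (stmt-PneNP-10637), proved** by the line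
`kotzig-cutspan`: if `NP ⊆ P` over `{0,1}` then Hamiltonicity of the graph of an `m × m` Boolean
matrix has polynomial-size `Bud(m, ⌊log₂ m⌋)`-symmetric threshold circuits at every `m`. -/
theorem HamCompiles_proof : Summit.PneNP.PneNP.Theses.SymmetryBudget.HamCompiles :=
  HamCompilesKC.HamCompiles_of

end Summit.PneNP.PneNP.Theorems
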